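import Literature.LinearAlgebra.Matrix.CauchyDeterminant
import Literature.Probability.LatticeModels.PlanarIsingWuDiag
import HarnessLib

/-!
# Wu's critical diagonal correlation as a Cauchy determinant: `det (2/(π(2(j-i)+1)))_{i,j<n} = wuDiag n`

Topic `Probability/LatticeModels`, namespace `Literature.Probability.LatticeModels`. Companion of
`PlanarIsingWuDiag` (Wu's product `wuDiag`, the recurrence `wuDiag (n+1) = wuDiag n · wuRatio n`,
`eq_wuDiag_of_wuRatio`) on the route to the named fact `wu_rhoCHI` through the diagonal transfer
matrix (`DiagonalTransferMatrix`, `TransverseIsingFermions`): there the critical diagonal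
correlation at distance `n` comes out as the `N → ∞` limit of an `n × n` determinant whose entries
tend to the CAUCHY kernel

  `c(i, j) = 2 / (π (2(j - i) + 1)) = π⁻¹ · 1/(x_j - y_i)`,  `x_j = j + ½`, `y_i = i`

(`critDiagMatrix`; B. M. McCoy, T. T. Wu, *The two-dimensional Ising model* (1973), Ch. XI: at
`T = T_c` the diagonal Toeplitz elements are `a_n = 1/(π(n + ½))`-type and the determinant is
evaluated in closed form by Cauchy's formula; P. Pfeuty, Ann. Phys. 57 (1970) 79, the same
determinant for the critical transverse-field Ising chain). This file PROVES

* `det_critDiagMatrix_succ` — `det c_{n+1} = det c_n · wuRatio n`, from the recurrence of Cauchy's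
  double alternant (`Literature.LinearAlgebra.Matrix.det_cauchyMatrix_succ`) at `x_k = k + ½`,
  `y_k = k`: the ratio is `π⁻¹ · 2 ∏_{k=1}^{n} k²/(k² - ¼) = (2/π) / ∏_{j<n} (1 - 1/(4(j+1)²)) = wuRatio n`
  (`wuRatio_eq_div_prod`);
* `det_critDiagMatrix` — **`det (2/(π(2(j-i)+1)))_{i,j<n} = wuDiag n`** (`eq_wuDiag_of_wuRatio`).

No named fact; everything is proved.

## References

* B. M. McCoy, T. T. Wu, *The two-dimensional Ising model*, Harvard Univ. Press (1973), Ch. XI.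
* T. T. Wu, Phys. Rev. 149 (1966) 380–401.
* P. Pfeuty, Ann. Phys. 57 (1970) 79–90.
* C. Krattenthaler, *Advanced determinant calculus* (1999), eq. (2.7).
-/

noncomputable section

open Matrix Finset Real Literature.LinearAlgebra.Matrix

namespace Literature.Probability.LatticeModels

/-- **The critical diagonal kernel** `c(i, j) = 2/(π(2(j - i) + 1))`, `i, j < n`: the `N → ∞` limit
of the contraction matrix of the critical diagonal cylinder state (McCoy–Wu 1973, Ch. XI: the
Toeplitz elements of the diagonal correlation at `T_c`). [cite: MccoyWu1973, Ch. XI (the diagonal correlation ⟨σ_{0,0}σ_{N,N}⟩ at T = T_c)] -/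
def critDiagMatrix (n : ℕ) : Matrix (Fin n) (Fin n) ℝ :=
  Matrix.of fun i j : Fin n => 2 / (π * (2 * ((j : ℕ) - (i : ℕ) : ℝ) + 1))

/-- Entries of the kernel. [folklore] -/
@[simp] theorem critDiagMatrix_apply (n : ℕ) (i j : Fin n) :
    critDiagMatrix n i j = 2 / (π * (2 * ((j : ℕ) - (i : ℕ) : ℝ) + 1)) := rfl

/-- The half-integer abscissae `x_k = k + ½`. [folklore] -/
def wuX (k : ℕ) : ℝ := k + 1 / 2

/-- The integer ordinates `y_k = k`. [folklore] -/
def wuY (k : ℕ) : ℝ := k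

/-- `x_i ≠ y_j`: a half-integer is not an integer. [folklore] -/
theorem wuX_ne_wuY (i j : ℕ) : wuX i ≠ wuY j := by
  intro h
  unfold wuX wuY at h
  have h2 : (2 * i + 1 : ℝ) = 2 * j := by linarith
  have h3 : (2 * i + 1 : ℕ) = 2 * j := by exact_mod_cast h2
  omega

/-- **The kernel is `π⁻¹` times the transpose of a Cauchy matrix**:
`c(i, j) = π⁻¹ (x_j - y_i)⁻¹` with `x_k = k + ½`, `y_k = k`. [folklore] -/
theorem critDiagMatrix_eq (n : ℕ) : critDiagMatrix n = π⁻¹ • (cauchyMatrix wuX wuY n)ᵀ := by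
  ext i j
  rw [critDiagMatrix_apply, Matrix.smul_apply, transpose_apply, cauchyMatrix_apply, wuX, wuY, smul_eq_mul]
  have h : ((j : ℕ) : ℝ) + 1 / 2 - (i : ℕ) = (2 * ((j : ℕ) - (i : ℕ) : ℝ) + 1) / 2 := by ring
  rw [h, inv_div, div_eq_mul_inv, div_eq_mul_inv, mul_inv]
  ring

/-- `det c_n = π^{-n} det C_n`. [folklore] -/
theorem det_critDiagMatrix_eq (n : ℕ) : (critDiagMatrix n).det = π⁻¹ ^ n * (cauchyMatrix wuX wuY n).det := by
  rw [critDiagMatrix_eq, det_smul, det_transpose, Fintype.card_fin]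

/-- The numerator factors of the Cauchy step at `x_k = k + ½`, `y_k = k`:
`(x_n - x_i)(y_i - y_n) = -(n - i)²`. [folklore] -/
theorem wu_num_factor (n i : ℕ) : (wuX n - wuX i) * (wuY i - wuY n) = -(((n : ℝ) - i) ^ 2) := by
  unfold wuX wuY; ring

/-- The denominator factors: `(x_n - y_i)(x_i - y_n) = -((n - i)² - ¼)`. [folklore] -/
theorem wu_den_factor (n i : ℕ) : (wuX n - wuY i) * (wuX i - wuY n) = -((((n : ℝ) - i) ^ 2) - 1 / 4) := by
  unfold wuX wuY; ring

/-- `x_n - y_n = ½`. [folklore] -/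
theorem wuX_sub_wuY_self (n : ℕ) : wuX n - wuY n = 1 / 2 := by unfold wuX wuY; ring

/-- The termwise ratio is the reciprocal Wu factor: for `i < n`,
`(n-i)²/((n-i)² - ¼) = 1/(1 - 1/(4(n-i)²)) = (wuFactor (n-1-i))⁻¹`. [folklore] -/
theorem wu_factor_ratio {n i : ℕ} (hi : i < n) :
    -(((n : ℝ) - i) ^ 2) / -((((n : ℝ) - i) ^ 2) - 1 / 4) = (wuFactor (n - 1 - i))⁻¹ := by
  rw [wuFactor]
  have hk : ((n - 1 - i : ℕ) : ℝ) + 1 = (n : ℝ) - i := by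
    rw [Nat.cast_sub (by omega), Nat.cast_sub (by omega)]
    push_cast
    ring
  rw [hk]
  have hpos : (1 : ℝ) ≤ (n : ℝ) - i := by
    have : ((i : ℕ) : ℝ) + 1 ≤ n := by exact_mod_cast hi
    linarith
  have h1 : ((n : ℝ) - i) ^ 2 ≠ 0 := by positivity
  have h2 : ((n : ℝ) - i) ^ 2 - 1 / 4 ≠ 0 := by nlinarith
  have h3 : 4 * ((n : ℝ) - i) ^ 2 ≠ 0 := by positivity
  field_simp

/-- **The Cauchy ratio at the half-integer points is Wu's ratio**:
`∏_{i<n} (x_n - x_i)(y_i - y_n) / ((x_n - y_n) ∏_{i<n} (x_n - y_i)(x_i - y_n)) = 2 / ∏_{j<n} wuFactor j`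
(`= π · wuRatio n`). [cite: MccoyWu1973, Ch. XI (evaluation of the critical diagonal determinant)] -/
theorem wu_cauchy_ratio (n : ℕ) :
    (∏ i ∈ range n, ((wuX n - wuX i) * (wuY i - wuY n))) /
        ((wuX n - wuY n) * ∏ i ∈ range n, ((wuX n - wuY i) * (wuX i - wuY n))) =
      2 / ∏ j ∈ range n, wuFactor j := by
  simp only [wu_num_factor, wu_den_factor, wuX_sub_wuY_self]
  rw [mul_comm (1 / 2 : ℝ), ← div_div, ← Finset.prod_div_distrib,
    Finset.prod_congr rfl fun i hi => wu_factor_ratio (mem_range.1 hi),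
    Finset.prod_range_reflect (fun j => (wuFactor j)⁻¹) n, Finset.prod_inv_distrib]
  ring

/-- **The recurrence**: `det c_{n+1} = det c_n · wuRatio n` — the Cauchy step
(`det_cauchyMatrix_succ`) at `x_k = k + ½`, `y_k = k` divided by `π`. [cite: MccoyWu1973, Ch. XI (evaluation of the critical diagonal determinant)] -/
theorem det_critDiagMatrix_succ (n : ℕ) :
    (critDiagMatrix (n + 1)).det = (critDiagMatrix n).det * wuRatio n := by
  rw [det_critDiagMatrix_eq, det_critDiagMatrix_eq,
    det_cauchyMatrix_succ wuX wuY n (fun i j _ _ => wuX_ne_wuY i j), wu_cauchy_ratio, wuRatio_eq_div_prod,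
    pow_succ]
  ring

/-- `det c_0 = 1`. [folklore] -/
theorem det_critDiagMatrix_zero : (critDiagMatrix 0).det = 1 := Matrix.det_isEmpty

/-- **Wu's critical diagonal correlation as a Cauchy determinant** (McCoy–Wu 1973, Ch. XI;
Wu 1966): `det (2/(π(2(j-i)+1)))_{i,j<n} = wuDiag n = (2/π)^n ∏_{l<n} (1 - 1/(4l²))^{l-n}`. [cite: MccoyWu1973, Ch. XI (the diagonal correlation ⟨σ_{0,0}σ_{N,N}⟩ at T = T_c)] -/
theorem det_critDiagMatrix (n : ℕ) : (critDiagMatrix n).det = wuDiag n :=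
  eq_wuDiag_of_wuRatio (D := fun n => (critDiagMatrix n).det) det_critDiagMatrix_zero det_critDiagMatrix_succ n

end Literature.Probability.LatticeModels
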